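import Summits.AtomisticToContinuum.Crystallization.Theorems.LoopTunnelDialForcePricingFrameSharp

/-!
# LoopTunnelDial — FORCE PRICING kit 16 (ii) «REPLAY»: the computable ℚ-mirror of the rows; the (δ) replay by kernel `decide`

Licensed by critic rows 378 (5) / 380 (6) (the only lens-5 work before census TAG 129′(α)).  §13 (a) COMPUTABLE ℚ copies `sHiQ … rowSharp2Q` of the
rows of kits 15 B/C (bodies verbatim) + cast lemmas `((fQ x : ℚ) : ℝ) = f ↑x`.  (b) Boolean exclusion row `excludedQ` (⇒ `Excluded`); the a-box checker
`gridCheck c a₁ a₂ R Λ g n drop : Bool` = ONE `decide` over `Fintype.piFinset (range ∘ n)` of «signs, grid covers `[−R, R]³`, mesh rows, `excludedQ`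
on dropped boxes, `Σ_live (rowSharp2Q)₊ ≤ Λ»; `gridCheck_sound : … = true → (gridCert (rowSharp2 c a₁ a₂) g n drop).BoxValid c a₁ a₂ R ∧ bound ≤ Λ`
(kit 15 `gridCert_boxValid` + `rowServes_rowSharp2` + the bound identity); `gridCheck_of_slabs` (first-index slabs `slabCheck` = the kernel-memory
unit: MEASURED — the whole 25³ range-5 grid in ONE kernel `decide` trips `(kernel) excessive memory consumption`, 3375 boxes pass in 140 s, and the
25³ grid BY 25 SLABS passes in 25 × 28 s, standard axioms; slab budgets must be EXACT rationals: box rows tie at `49/100` and floats mis-drop); HOT =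
`ContactHotAbove (3/4)` (stub 3 of T `PocketCase`, stmt-AtomisticToContinuum-27294) by `contactHotAbove_threeQuarters_of_gridChecks` (mod `e⋆ ≤ −0.711`)
from one passing `gridCheck` per a-box.  TAG 129′(δ) thus emits ONLY ℚ/ℕ tables `b, g, n` (+ slab budgets `q`; `drop := excludedQ …` is computed) and
every proof is `by decide +kernel` — STANDARD axioms, no `native_decide`.  (c) kit 15 C's toy so replayed: `toyQ_finPricedLoadCap : FinPricedLoadCap
(3/4) (8/125) 146 (9/10)` (5³ grid, 20 boxes dropped by their own exclusion rows, 105 live, Σ (rowSharp2Q)₊ = 145.33…; kernel ≈ 2 s).  HONEST LIMITS: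
singleton cliques — this certifies the PLUMBING, not a better number (clique / LP-dual checker = kit 16 (i), unlicensed); no new dial, road, stub.  0 sorry.
-/

namespace Summit.AtomisticToContinuum.Crystallization.Theorems.LoopTunnelDialForcePricing
open scoped BigOperators
open Summit.AtomisticToContinuum.Crystallization.Theorems.ChargedEnergyGapNegative (eStar)
open Summit.AtomisticToContinuum.Crystallization.Theorems.LoopTunnelDialContactLaw

/-! ### §13 (a) The ℚ-mirror of the rows of kits 15 B/C + cast lemmas (every `def` of this file: line vocabulary · crux stmt-AtomisticToContinuum-27294 · computable mirror / checker, not a cited fact) -/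
/-- ℚ-mirror of `sHi`. -/ def sHiQ (lo hi : Fin 3 → ℚ) : ℚ := max (lo 0 ^ 2) (hi 0 ^ 2) + max (lo 1 ^ 2) (hi 1 ^ 2) + max (lo 2 ^ 2) (hi 2 ^ 2)
/-- ℚ-mirror of `sLo`. -/ def sLoQ (lo hi : Fin 3 → ℚ) : ℚ :=
  max (max (lo 0) (-hi 0)) 0 ^ 2 + max (max (lo 1) (-hi 1)) 0 ^ 2 + max (max (lo 2) (-hi 2)) 0 ^ 2
/-- ℚ-mirror of `phi`. -/ def phiQ (s : ℚ) : ℚ := s⁻¹ ^ 3 / 6 - s⁻¹ ^ 6 / 12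
/-- ℚ-mirror of `hPlus`. -/ def hPlusQ (sl : ℚ) : ℚ := sl⁻¹ ^ 4 * max (sl⁻¹ ^ 3 - 1) 0
/-- ℚ-mirror of `hMinus`. -/ def hMinusQ (sl su : ℚ) : ℚ := (max sl 1)⁻¹ ^ 4 * max (1 - su⁻¹ ^ 3) 0
/-- ℚ-mirror of `nvBound`. -/ def nvBoundQ (sl su : ℚ) : ℚ := if su ≤ 1 then phiQ su else if 1 ≤ sl then phiQ sl else 1 / 12
/-- ℚ-mirror of `rowBound`. -/ def rowBoundQ (c a : ℚ) (lo hi : Fin 3 → ℚ) : ℚ :=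
  nvBoundQ (max (sLoQ lo hi) (49 / 100)) (sHiQ lo hi) +
    c * a * (hPlusQ (max (sLoQ lo hi) (49 / 100)) * max (-lo 2) 0 + hMinusQ (max (sLoQ lo hi) (49 / 100)) (sHiQ lo hi) * max (hi 2) 0)
/-- ℚ-mirror of `Pw`. -/ def PwQ (κ w : ℚ) : ℚ := w ^ 3 / 6 - w ^ 6 / 12 + κ * (w ^ 7 - w ^ 4)
/-- ℚ-mirror of `dPw`. -/ def dPwQ (κ w : ℚ) : ℚ := w ^ 2 / 2 - w ^ 5 / 2 + κ * (7 * w ^ 6 - 4 * w ^ 3)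
/-- ℚ-mirror of `EwU`. -/ def EwUQ (κ wl wu : ℚ) : ℚ := wu / 2 - 5 * wl ^ 4 / 4 + κ * (21 * wu ^ 5 - 6 * wl ^ 2)
/-- ℚ-mirror of `rowIn` (`κ, w_l, w_u`, midpoint, half-width as there). -/ def rowInQ (c a : ℚ) (lo hi : Fin 3 → ℚ) : ℚ :=
  let κ := c * a * max (-lo 2) 0; let wl := (sHiQ lo hi)⁻¹; let wu := (max (sLoQ lo hi) (49 / 100))⁻¹
  PwQ κ ((wl + wu) / 2) + max (dPwQ κ ((wl + wu) / 2)) (-dPwQ κ ((wl + wu) / 2)) * ((wu - wl) / 2) + ((wu - wl) / 2) ^ 2 * max (EwUQ κ wl wu) 0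
/-- ℚ-mirror of `rowSharp`. -/ def rowSharpQ (c a : ℚ) (lo hi : Fin 3 → ℚ) : ℚ :=
  if sHiQ lo hi ≤ 1 then min (rowBoundQ c a lo hi) (rowInQ c a lo hi) else rowBoundQ c a lo hi
/-- ℚ-mirror of `rowSharp2`, the row of record. -/
def rowSharp2Q (c a₁ a₂ : ℚ) (lo hi : Fin 3 → ℚ) : ℚ := max (rowSharpQ c a₁ lo hi) (rowSharpQ c a₂ lo hi)
section Casts
variable (c a a₁ a₂ s sl su κ w wl wu : ℚ) (lo hi : Fin 3 → ℚ)
/-- `ℚ → ℝ` cast is monotone (≤). -/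
private theorem cast_le' {x y : ℚ} (h : x ≤ y) : (x : ℝ) ≤ y := (Rat.cast_le (K := ℝ)).2 h
/-- `ℚ → ℝ` cast is monotone (<). -/
private theorem cast_lt' {x y : ℚ} (h : x < y) : (x : ℝ) < y := (Rat.cast_lt (K := ℝ)).2 h
/-- Cast lemma. -/ theorem cast_sHiQ : ((sHiQ lo hi : ℚ) : ℝ) = sHi (fun k => (lo k : ℝ)) (fun k => (hi k : ℝ)) := by
  simp only [sHiQ, sHi]; push_cast; rfl
/-- Cast lemma. -/ theorem cast_sLoQ : ((sLoQ lo hi : ℚ) : ℝ) = sLo (fun k => (lo k : ℝ)) (fun k => (hi k : ℝ)) := by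
  simp only [sLoQ, sLo]; push_cast; rfl
/-- Cast lemma. -/ theorem cast_phiQ : ((phiQ s : ℚ) : ℝ) = phi s := by simp only [phiQ, phi]; push_cast; rfl
/-- Cast lemma. -/ theorem cast_hPlusQ : ((hPlusQ sl : ℚ) : ℝ) = hPlus sl := by simp only [hPlusQ, hPlus]; push_cast; rfl
/-- Cast lemma. -/ theorem cast_hMinusQ : ((hMinusQ sl su : ℚ) : ℝ) = hMinus sl su := by simp only [hMinusQ, hMinus]; push_cast; rfl
/-- Cast lemma (the two `if`s agree by `Rat.cast_le`). -/ theorem cast_nvBoundQ : ((nvBoundQ sl su : ℚ) : ℝ) = nvBound sl su := by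
  have e1 : (su ≤ 1) = ((su : ℝ) ≤ 1) := propext (by norm_cast)
  have e2 : (1 ≤ sl) = ((1 : ℝ) ≤ sl) := propext (by norm_cast)
  simp only [nvBoundQ, nvBound, apply_ite (Rat.cast : ℚ → ℝ), cast_phiQ, e1, e2]; norm_num
/-- Cast lemma. -/ theorem cast_rowBoundQ : ((rowBoundQ c a lo hi : ℚ) : ℝ) = rowBound c a (fun k => (lo k : ℝ)) (fun k => (hi k : ℝ)) := by
  simp only [rowBoundQ, rowBound]; push_cast [cast_nvBoundQ, cast_hPlusQ, cast_hMinusQ, cast_sHiQ, cast_sLoQ]; rfl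
/-- Cast lemma. -/ theorem cast_PwQ : ((PwQ κ w : ℚ) : ℝ) = Pw κ w := by simp only [PwQ, Pw]; push_cast; rfl
/-- Cast lemma. -/ theorem cast_dPwQ : ((dPwQ κ w : ℚ) : ℝ) = dPw κ w := by simp only [dPwQ, dPw]; push_cast; rfl
/-- Cast lemma. -/ theorem cast_EwUQ : ((EwUQ κ wl wu : ℚ) : ℝ) = EwU κ wl wu := by simp only [EwUQ, EwU]; push_cast; rfl
/-- Cast lemma. -/ theorem cast_rowInQ : ((rowInQ c a lo hi : ℚ) : ℝ) = rowIn c a (fun k => (lo k : ℝ)) (fun k => (hi k : ℝ)) := by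
  simp only [rowInQ, rowIn]; push_cast [cast_PwQ, cast_dPwQ, cast_EwUQ, cast_sHiQ, cast_sLoQ]; rfl
/-- Cast lemma. -/ theorem cast_rowSharpQ : ((rowSharpQ c a lo hi : ℚ) : ℝ) = rowSharp c a (fun k => (lo k : ℝ)) (fun k => (hi k : ℝ)) := by
  have e : (sHiQ lo hi ≤ 1) = (sHi (fun k => (lo k : ℝ)) (fun k => (hi k : ℝ)) ≤ 1) := by rw [← cast_sHiQ]; exact propext (by norm_cast)
  simp only [rowSharpQ, rowSharp, apply_ite (Rat.cast : ℚ → ℝ), Rat.cast_min, cast_rowBoundQ, cast_rowInQ, e]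
/-- **Cast lemma for the row of record:** `rowSharp2Q` computes kit 15 C's `rowSharp2` exactly. -/
theorem cast_rowSharp2Q : ((rowSharp2Q c a₁ a₂ lo hi : ℚ) : ℝ) = rowSharp2 c a₁ a₂ (fun k => (lo k : ℝ)) (fun k => (hi k : ℝ)) := by
  simp only [rowSharp2Q, rowSharp2]; push_cast [cast_rowSharpQ]; rfl
end Casts

/-! ### §13 (b) The Boolean exclusion row, the ONE-`decide` a-box checker, soundness, and HOT from the checks -/
/-- Boolean mirror of kit 15 B's `Excluded R a₁ a₂ lo hi` (inner ∣ outer ∣ partner ball at BOTH ends of the a-box). -/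
def excludedQ (R a₁ a₂ : ℚ) (lo hi : Fin 3 → ℚ) : Bool :=
  decide (sHiQ lo hi < 49 / 100 ∨ R ^ 2 < sLoQ lo hi ∨
    (max (lo 0 ^ 2) (hi 0 ^ 2) + max (lo 1 ^ 2) (hi 1 ^ 2) + max ((lo 2 - a₁) ^ 2) ((hi 2 - a₁) ^ 2) < 49 / 100 ∧
      max (lo 0 ^ 2) (hi 0 ^ 2) + max (lo 1 ^ 2) (hi 1 ^ 2) + max ((lo 2 - a₂) ^ 2) ((hi 2 - a₂) ^ 2) < 49 / 100))
/-- `excludedQ` is sound for `Excluded`. -/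
theorem excluded_of_excludedQ {R a₁ a₂ : ℚ} {lo hi : Fin 3 → ℚ} (h : excludedQ R a₁ a₂ lo hi = true) :
    Excluded (R : ℝ) a₁ a₂ (fun k => (lo k : ℝ)) (fun k => (hi k : ℝ)) := by
  unfold Excluded; rw [← cast_sHiQ, ← cast_sLoQ]
  rcases of_decide_eq_true h with h1 | h2 | ⟨h3, h4⟩
  exacts [Or.inl (by simpa using cast_lt' h1), Or.inr (Or.inl (by simpa using cast_lt' h2)),
    Or.inr (Or.inr ⟨by simpa using cast_lt' h3, by simpa using cast_lt' h4⟩)]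
/-- **`gridCheck` — THE a-BOX CHECKER**, ONE Boolean over the grid boxes `j` (`j k < n k`): signs, extent `[−R, R]³`, mesh rows, `excludedQ` on dropped boxes, `Σ_live (rowSharp2Q)₊ ≤ Λ`. -/
def gridCheck (c a₁ a₂ R Λ : ℚ) (g : Fin 3 → ℕ → ℚ) (n : Fin 3 → ℕ) (drop : (Fin 3 → ℕ) → Bool) : Bool :=
  decide (0 ≤ c ∧ 0 ≤ a₁ ∧ a₁ ≤ a₂ ∧ 0 ≤ R ∧ (∀ k, 0 < n k) ∧ (∀ k, g k 0 ≤ -R) ∧ (∀ k, R ≤ g k (n k)) ∧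
    (∀ j ∈ Fintype.piFinset fun k => Finset.range (n k),
      (g 0 (j 0 + 1) - g 0 (j 0)) ^ 2 + (g 1 (j 1 + 1) - g 1 (j 1)) ^ 2 + (g 2 (j 2 + 1) - g 2 (j 2)) ^ 2 < 49 / 100 ∧
      (drop j = true → excludedQ R a₁ a₂ (fun k => g k (j k)) (fun k => g k (j k + 1)) = true)) ∧
    (∑ j ∈ (Fintype.piFinset fun k => Finset.range (n k)).filter (fun j => drop j = false),
      max (rowSharp2Q c a₁ a₂ (fun k => g k (j k)) (fun k => g k (j k + 1))) 0) ≤ Λ)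
/-- **THE CHECKER IS SOUND (PROVED):** `gridCheck … = true` ⇒ kit 15's censored grid certificate with the row of record is box-valid on `[a₁, a₂]` at price `c`, range `R`, with bound `≤ Λ`. -/
theorem gridCheck_sound {c a₁ a₂ R Λ : ℚ} {g : Fin 3 → ℕ → ℚ} {n : Fin 3 → ℕ} {drop : (Fin 3 → ℕ) → Bool}
    (h : gridCheck c a₁ a₂ R Λ g n drop = true) :
    (gridCert (rowSharp2 (c : ℝ) a₁ a₂) (fun k i => (g k i : ℝ)) n (fun j => drop j = true)).BoxValid c a₁ a₂ R ∧
    (gridCert (rowSharp2 (c : ℝ) a₁ a₂) (fun k i => (g k i : ℝ)) n (fun j => drop j = true)).bound ≤ Λ := by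
  obtain ⟨hc, ha₁, h12, hR, hn, hlo, hhi, hcell, hsum⟩ := of_decide_eq_true h
  have hmem : ∀ j : Fin 3 → ℕ, (∀ k, j k < n k) → j ∈ Fintype.piFinset fun k => Finset.range (n k) := fun j hj => Fintype.mem_piFinset.2 fun k => Finset.mem_range.2 (hj k)
  refine ⟨gridCert_boxValid (by exact_mod_cast hR)
      (rowServes_rowSharp2 (by exact_mod_cast hc) (by exact_mod_cast ha₁) (by exact_mod_cast h12)) hn
      (fun k => by exact_mod_cast hlo k) (fun k => by exact_mod_cast hhi k)
      (fun j hj => by simpa [gridHi, gridLo] using cast_lt' (hcell j (hmem j hj)).1)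
      (fun j hj hd => excluded_of_excludedQ ((hcell j (hmem j hj)).2 hd)), Eq.trans_le ?_ (cast_le' hsum)⟩
  unfold CellCert.bound; dsimp only [gridCert] -- the bound identity: Σ over singleton cliques of live cells = the ℚ sum, cast
  rw [Finset.sum_image fun K _ K' _ hK => Finset.singleton_injective hK,
    Finset.sum_image fun i _ i' _ hi => by rw [← decd_enc i, hi, decd_enc], Rat.cast_sum]
  refine Finset.sum_congr (Finset.ext fun j => by simp only [Finset.mem_filter, Bool.not_eq_true]) fun j _ => ?_
  simp only [Finset.sum_singleton, decd_enc, Rat.cast_max, Rat.cast_zero, cast_rowSharp2Q]; rfl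
/-- **Slab `i` of the checker** (boxes with first index `i`): mesh / exclusion rows and live-row sum `≤ q` — the kernel-memory unit of the replay. -/
def slabCheck (c a₁ a₂ R q : ℚ) (g : Fin 3 → ℕ → ℚ) (n : Fin 3 → ℕ) (drop : (Fin 3 → ℕ) → Bool) (i : ℕ) : Bool :=
  decide ((∀ j ∈ (Fintype.piFinset fun k => Finset.range (n k)).filter (fun j => j 0 = i),
      (g 0 (j 0 + 1) - g 0 (j 0)) ^ 2 + (g 1 (j 1 + 1) - g 1 (j 1)) ^ 2 + (g 2 (j 2 + 1) - g 2 (j 2)) ^ 2 < 49 / 100 ∧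
      (drop j = true → excludedQ R a₁ a₂ (fun k => g k (j k)) (fun k => g k (j k + 1)) = true)) ∧
    (∑ j ∈ ((Fintype.piFinset fun k => Finset.range (n k)).filter (fun j => j 0 = i)).filter (fun j => drop j = false),
      max (rowSharp2Q c a₁ a₂ (fun k => g k (j k)) (fun k => g k (j k + 1))) 0) ≤ q)
/-- **SLABS ⇒ CHECK (PROVED):** signs / extent / `Σ_i q i ≤ Λ` (one small `decide`) + `slabCheck … (q i) … i = true` for all `i < n 0` (one kernel `decide` each) ⇒ `gridCheck = true`. -/
theorem gridCheck_of_slabs {c a₁ a₂ R Λ : ℚ} {g : Fin 3 → ℕ → ℚ} {n : Fin 3 → ℕ} {drop : (Fin 3 → ℕ) → Bool} (q : ℕ → ℚ)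
    (h0 : decide (0 ≤ c ∧ 0 ≤ a₁ ∧ a₁ ≤ a₂ ∧ 0 ≤ R ∧ (∀ k, 0 < n k) ∧ (∀ k, g k 0 ≤ -R) ∧ (∀ k, R ≤ g k (n k)) ∧
      ∑ i ∈ Finset.range (n 0), q i ≤ Λ) = true)
    (h : ∀ i < n 0, slabCheck c a₁ a₂ R (q i) g n drop i = true) : gridCheck c a₁ a₂ R Λ g n drop = true := by
  obtain ⟨hc, ha₁, h12, hR, hn, hlo, hhi, hq⟩ := of_decide_eq_true h0
  refine decide_eq_true ⟨hc, ha₁, h12, hR, hn, hlo, hhi, fun j hj => ?_, ?_⟩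
  · exact (of_decide_eq_true (h _ (Finset.mem_range.1 (Fintype.mem_piFinset.1 hj 0)))).1 j (Finset.mem_filter.2 ⟨hj, rfl⟩)
  · rw [← Finset.sum_fiberwise_of_maps_to (t := Finset.range (n 0)) (g := fun j : Fin 3 → ℕ => j 0)
      fun j hj => Fintype.mem_piFinset.1 (Finset.mem_filter.1 hj).1 0]
    exact (Finset.sum_le_sum fun i hi => by rw [Finset.filter_comm]; exact (of_decide_eq_true (h i (Finset.mem_range.1 hi))).2).trans hq
/-- **HOT FROM PER-a-BOX CHECKS (PROVED mod `e⋆ ≤ −0.711`):** breakpoints `b 0 ≤ 7/10`, `3/4 ≤ b m`, one passing `gridCheck` (price `8/125`, range `5`, budget `77/20`) per pair — one `decide +kernel` per a-box, separate files allowed. -/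
theorem contactHotAbove_threeQuarters_of_gridChecks (he : eStar ≤ -(711 / 1000)) {b : ℕ → ℚ} {m : ℕ} (hm : 0 < m) (hb0 : b 0 ≤ 7 / 10)
    (hbm : 3 / 4 ≤ b m) {g : ℕ → Fin 3 → ℕ → ℚ} {n : ℕ → Fin 3 → ℕ} {drop : ℕ → (Fin 3 → ℕ) → Bool}
    (h : ∀ j < m, gridCheck (8 / 125) (b j) (b (j + 1)) 5 (77 / 20) (g j) (n j) (drop j) = true) : ContactHotAbove (3 / 4) := by
  refine contactHotAbove_threeQuarters_of_boxCerts5 he (fun j => (b j : ℝ)) m hm (by simpa using cast_le' hb0)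
    (by simpa using cast_le' hbm) fun j hj => ?_
  obtain ⟨hV, hB⟩ := gridCheck_sound (h j hj); push_cast at hV hB; exact ⟨_, hV, hB⟩
/-! ### §13 (c) Kit 15 C's toy replayed from its table by ONE kernel `decide` (drop-list = the exclusion rows themselves) -/
/-- Kit 15 C's toy grid in ℚ: breakpoints `−9/10 + (9/25)·j` on every axis. -/
def toyGQ : Fin 3 → ℕ → ℚ := fun _ j => -(9 / 10) + 9 / 25 * j
/-- THE TOY CHECK by ONE kernel `decide` (125 boxes, 20 dropped by their own exclusion rows, 105 live rows, `Σ (rowSharp2Q)₊ = 145.33… ≤ 146`). -/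
theorem toyQ_gridCheck : gridCheck (8 / 125) (7 / 10) (3 / 4) (9 / 10) 146 toyGQ (fun _ => 5)
    (fun j => excludedQ (9 / 10) (7 / 10) (3 / 4) (fun k => toyGQ k (j k)) (fun k => toyGQ k (j k + 1))) = true := by decide +kernel
/-- **THE TOY REPLAYED FROM THE TABLE (PROVED, standard axioms):** `FinPricedLoadCap (3/4) (8/125) 146 (9/10)`. -/
theorem toyQ_finPricedLoadCap : FinPricedLoadCap (3 / 4) (8 / 125) 146 (9 / 10) :=
  finPricedLoadCap_of_boxCerts (fun j => if j = 0 then 7 / 10 else 3 / 4) 1 one_pos (by norm_num) (by norm_num) fun j hj => by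
    obtain rfl : j = 0 := by omega
    obtain ⟨hV, hB⟩ := gridCheck_sound toyQ_gridCheck; exact ⟨_, by simpa using hV, by simpa using hB⟩

end Summit.AtomisticToContinuum.Crystallization.Theorems.LoopTunnelDialForcePricing
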